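import Literature.Computability.Complexity.MurrayWilliams2018SimulationMachine
import Literature.Computability.Complexity.MurrayWilliams2018SimulationQ
import HarnessLib

/-!
# Murray–Williams 2018, Lemma 4.1 with a polylogarithmic-seed generator: the machine of the
# derandomised advice-taking simulation `N`

Literature / circuit complexity — derandomization. The MACHINE half of the polylogarithmic-seed
simulation `hsimQ` of `MurrayWilliams2018EasyWitnessAssemblyQP.lean` (from which Murray–Williams'
Lemma 1.3, Theorem 1.2 for `AC⁰[m]` and Theorem 1.3 follow there and in
`MurrayWilliams2018Lemma13QP.lean`): the nondeterministic algorithm `N` of the printed proof of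
Lemma 4.1 (C. D. Murray, R. R. Williams, STOC 2018 = SIAM J. Comput. 49(5), 2020, p. 315: guess a
hard witness `y_hard`, check it with `V`, use it as the table of a pseudorandom generator, guess
Merlin's message, enumerate all seeds and take the majority vote of Arthur's predicate), run with
a generator whose seeds have length `c · M^{sx}` at table scale `M` — the PROVED generator of
Impagliazzo–Kabanets–Wigderson's Thm. 11, `IKW2002_thm11_tableGenerator` — instead of Umans'
`O(M)`. It is the variant of `MWSimN` (`MurrayWilliams2018SimulationMachine.lean`, whose clock
stage, field conventions `xIn/xhIn/alphaIn/advIn`, preprocessed word `pre` and window `window` are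
REUSED) computing the behaviour `MWSimQ.verdictBit` of `MurrayWilliams2018SimulationQ.lean`:

* the table is `padTable y` (Murray–Williams' own table `y 1 0⋯0` defining `CC(y)`), the seed ruler
  is `1^{c (Nat.size |y|)^{sx}}` (`Nat.size |y| = ⌈log₂ (|y| + 1)⌉`, `natSize_eq_clog_succ`), the
  generator is read on `⟨padTable y, ⟨1^{nb}, seed⟩⟩` (`tableGenerator` format), `nb = QN(|⟨⟨x, α⟩,
  1^{m ℓ}⟩|)` for a polynomial `QN`;
* since `2^{c M^{sx}}` rounds are not polynomially many in the length of the record, the clock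
  stage appends an **exponential pad** `P = 1^{2^{σ*}+1}`, `σ* = c (Nat.size (c_V t n + c_V))^{sx} ≥`
  every seed length of an admissible witness, produced by the tree's exponential clock
  (`expClock 1 1`, `exists_timeComputable_expClock`) under `mapFstAux` — the device of
  `IKWSim.exists_clock_machine` (`IKWSimulationMachine.lean`); the fold over the seeds then runs
  with LINEAR capacity in the padded record, and the pad also serves as the ruler from which the
  table length `2^M` is measured (`binToUnaryFn`);
* **`exists_simLang_mem_NTIME`**: for `Ref ∈ P`, `F ∈ FP` there is `k` such that for all
  time-constructible monotone `t`, time-constructible `m ≤ t` (a.e.) and verifiers `V`, the pair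
  language `simLang` lies in `NTIME T` for EVERY `T` with `2^{k (log₂ t(n) + 2)ᵏ} ≤ T(n)` a.e. —
  the running time `poly(2^{σ*}, t|X|, …)` is `≤ D · 2^{(sx+1)(log₂ t|X| + 2)^{sx+1}} + D`
  (`two_pow_poly_log_le`), an upper bound needing no constructibility of `T`
  (`mem_NTIME_of_prefixMachine_pre`, `Williams2014MachineB.lean`);
* `verdictBit_word` — on well-formed words `⟨x, ⟨⟨x_h, α⟩, j⟩⟩` the machine's verdict IS
  `MWSimQ.verdictBit` (window `MWSimN.window`), so that the correctness theorems of
  `MurrayWilliams2018SimulationQ.lean` apply to `simLang` (`mem_simLang_iff_word`).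

Everything is proved; definitions with bodies only; no named fact is introduced (D-0026).

## References

* C. D. Murray, R. R. Williams, *Circuit lower bounds for nondeterministic quasi-polytime: an easy
  witness lemma for NP and NQP*, STOC 2018 = SIAM J. Comput. 49(5) (2020), proof of Lemma 4.1
  (SIAM pp. 315–316) [MurrayWilliams2018].
* R. Impagliazzo, V. Kabanets, A. Wigderson, *In search of an easy witness*, JCSS 65 (2002), §2.4,
  Thm. 11–12 [ImpagliazzoKabanetsWigderson2002].
* S. Arora, B. Barak, *Computational Complexity: A Modern Approach*, CUP 2009, proof of
  Lemma 20.3 (enumerate all seeds, majority), §1.3, Def. 2.1/§2.1.2 [AroraBarakCC2009].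
-/

noncomputable section

namespace Literature.Computability.Complexity

open _root_.Computability Turing Finset Filter Polynomial Brick Plumb

/-! ### Arithmetic preliminaries -/

/-- `Nat.size n = ⌈log₂ (n + 1)⌉` (the bit length is the scale of Murray–Williams' padded table).
[folklore] -/
theorem natSize_eq_clog_succ (n : ℕ) : Nat.size n = Nat.clog 2 (n + 1) := by
  apply le_antisymm
  · exact Nat.size_le.2 (Nat.lt_of_succ_le (Nat.le_pow_clog one_lt_two _))
  · exact (Nat.clog_le_iff_le_pow one_lt_two).2 (Nat.succ_le_of_lt (Nat.lt_size_self n))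

/-- The padded table as a padded take: `padTable y = takeD 2^M (y 1) 0`, `M = ⌈log₂ (|y|+1)⌉`.
[cite: MurrayWilliams2018, §2] -/
theorem padTable_eq_takeD (y : List Bool) :
    padTable y = List.takeD (2 ^ Nat.clog 2 (y.length + 1)) (y ++ [true]) false := by
  have h : (y ++ [true]).length ≤ 2 ^ Nat.clog 2 (y.length + 1) := by
    rw [List.length_append, List.length_singleton]; exact Nat.le_pow_clog one_lt_two _
  rw [MWSim.takeD_of_length_le h, padTable, List.append_assoc, List.length_append,
    List.length_singleton]
  rfl

namespace MWSimQN

/-! ### Stage 4: the verdict (majority vote of Arthur's predicate over all seeds)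

The verdict works on the record `R = ⟨P, ⟨⟨⟨x, α⟩, z⟩, ⟨U, y⟩⟩⟩` (pad, game input with Merlin's
message, the move length in unary `U = 1^{m ℓ}`, the hard witness); the pieces of the fold receive
`Z = ⟨R, 1ⁱ⟩`. -/

section Post

variable (Ref : Language Bool) (F : List Bool → List Bool) (c sx : ℕ) (QN : Polynomial ℕ)

/-- The pad `P` of a piece argument `⟨R, 1ⁱ⟩`. [folklore] -/
def PZ : List Bool → List Bool := fstF ∘ fstF
/-- The field `⟨⟨⟨x, α⟩, z⟩, ⟨U, y⟩⟩` of a piece argument. [folklore] -/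
def gZ : List Bool → List Bool := sndF ∘ fstF
/-- The field `⟨⟨x, α⟩, z⟩` of a piece argument. [folklore] -/
def xazZ : List Bool → List Bool := fstF ∘ gZ
/-- The field `⟨x, α⟩` of a piece argument. [folklore] -/
def xaZ : List Bool → List Bool := fstF ∘ xazZ
/-- The field `U = 1^{m ℓ}` of a piece argument. [folklore] -/
def umZ : List Bool → List Bool := fstF ∘ sndF ∘ gZ
/-- The field `y` (the hard witness) of a piece argument. [folklore] -/
def yZ : List Bool → List Bool := sndF ∘ sndF ∘ gZ
/-- The round index `1ⁱ` of a piece argument. [folklore] -/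
def iZ : List Bool → List Bool := sndF

/-- **The seed ruler** of a word `w`: `1^{c (Nat.size |w|)^{sx}}` — for the witness `y`, the seed
length `c ⌈log₂ (|y|+1)⌉^{sx}` of IKW's generator on the table `padTable y`.
[cite: ImpagliazzoKabanetsWigderson2002, Thm. 11] -/
def seedRuler : List Bool → List Bool := onesMulFn c ∘ polyFn (X ^ sx) ∘ lenBinF

/-- The `i`-th seed `ρᵢ = takeD σ (bin i)`. [folklore] -/
def seedZ : List Bool → List Bool :=
  fstF ∘ padTakeFn ∘ fanoutFn (seedRuler c sx ∘ yZ) (lenBinF ∘ iZ)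

/-- The numeral of `2^{Nat.size |w|}` (`0^{size} 1`). [folklore] -/
def pow2NumF : List Bool → List Bool := (fun w => Kannan.zerosFn w ++ [true]) ∘ lenBinF

/-- The table ruler `1^{2^M}`, `M = Nat.size |y|`, measured on the pad. [folklore] -/
def tableRulerZ : List Bool → List Bool := binToUnaryFn ∘ fanoutFn PZ (pow2NumF ∘ yZ)

/-- `y 1` (the witness followed by the marker bit of the padded table). [folklore] -/
def yOneZ : List Bool → List Bool := appF ∘ fanoutFn yZ fun _ => [true]

/-- **The table** `padTable y = takeD 2^M (y 1) 0`. [cite: MurrayWilliams2018, §2] -/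
def tableZ : List Bool → List Bool := fstF ∘ padTakeFn ∘ fanoutFn tableRulerZ yOneZ

/-- The output ruler `1^{nb}`, `nb = QN(|⟨⟨x, α⟩, U⟩|)`. [folklore] -/
def nbZ : List Bool → List Bool := polyFn QN ∘ fanoutFn xaZ umZ

/-- The generator's output on the `i`-th seed: `F ⟨padTable y, ⟨1^{nb}, ρᵢ⟩⟩`. [folklore] -/
def outZ : List Bool → List Bool := F ∘ fanoutFn tableZ (fanoutFn (nbZ QN) (seedZ c sx))

/-- Arthur's coins in round `i`: the first `m ℓ = |U|` output bits, padded. [folklore] -/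
def coinsZ : List Bool → List Bool := fstF ∘ padTakeFn ∘ fanoutFn umZ (outZ F c sx QN)

/-- **The piece of round `i`**: the bit `[⟨⟨⟨x, α⟩, z⟩, coinsᵢ⟩ ∈ Ref]` as a one-symbol string.
[folklore] -/
def pieceZ : List Bool → List Bool :=
  (fun w => encodeBool (Ref.boolIndicator w)) ∘ fanoutFn xazZ (coinsZ F c sx QN)

/-- Field `y` of the record `R`. [folklore] -/
def yR : List Bool → List Bool := sndF ∘ sndF ∘ sndF

/-- The number of seeds as a numeral: `R ↦ bin 2^σ = 0^σ 1`. [folklore] -/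
def cntNumR : List Bool → List Bool := (fun w => Kannan.zerosFn w ++ [true]) ∘ seedRuler c sx ∘ yR

/-- The fold's initial record `R ↦ ⟨R, ⟨bin 2^σ, ⟨1⁰, bin 0⟩⟩⟩`. [folklore] -/
def initR : List Bool → List Bool :=
  fanoutFn (fun w => w) (fanoutFn (cntNumR c sx) fun _ => boolPair [] [])

/-- **The number of accepting seeds**, as a numeral: the counted fold over `i < 2^σ` with capacity
`|R|` rounds (the pad makes the record long enough). [folklore] -/
def accR : List Bool → List Bool :=
  sndPow 2 ∘ foldLoop addFn (clipF 1 (pieceZ Ref F c sx QN)) X ∘ initR c sx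

/-- **The verdict on a record**: `[2^σ < 2 · #accepting seeds]`. [folklore] -/
def verdictR : List Bool → List Bool :=
  ltFn ∘ fanoutFn (cntNumR c sx) (addFn ∘ fanoutFn (accR Ref F c sx QN) (accR Ref F c sx QN))

/-- **Stage 4**: reject unless the verifier's bit (first component) is `1`, else the verdict on the
record (second component). [folklore] -/
def postF : List Bool → List Bool :=
  iteFn fstF (verdictR Ref F c sx QN ∘ sndF) fun _ => [false]

/-! #### Membership in `FP` -/

variable {Ref F}

/-- `gZ ∈ FP`. [folklore] -/
theorem gZ_mem_FP : gZ ∈ FP := comp_mem_FP sndF_mem_FP fstF_mem_FP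
/-- `PZ ∈ FP`. [folklore] -/
theorem PZ_mem_FP : PZ ∈ FP := comp_mem_FP fstF_mem_FP fstF_mem_FP
/-- `xazZ ∈ FP`. [folklore] -/
theorem xazZ_mem_FP : xazZ ∈ FP := comp_mem_FP fstF_mem_FP gZ_mem_FP
/-- `xaZ ∈ FP`. [folklore] -/
theorem xaZ_mem_FP : xaZ ∈ FP := comp_mem_FP fstF_mem_FP xazZ_mem_FP
/-- `umZ ∈ FP`. [folklore] -/
theorem umZ_mem_FP : umZ ∈ FP := comp_mem_FP fstF_mem_FP (comp_mem_FP sndF_mem_FP gZ_mem_FP)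
/-- `yZ ∈ FP`. [folklore] -/
theorem yZ_mem_FP : yZ ∈ FP := comp_mem_FP sndF_mem_FP (comp_mem_FP sndF_mem_FP gZ_mem_FP)
/-- `yR ∈ FP`. [folklore] -/
theorem yR_mem_FP : yR ∈ FP := comp_mem_FP sndF_mem_FP (comp_mem_FP sndF_mem_FP sndF_mem_FP)

/-- `seedRuler ∈ FP`. [folklore] -/
theorem seedRuler_mem_FP : seedRuler c sx ∈ FP :=
  comp_mem_FP (onesMulFn_mem_FP c) (comp_mem_FP (polyFn_mem_FP _) lenBinF_mem_FP)

/-- `seedZ ∈ FP`. [folklore] -/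
theorem seedZ_mem_FP : seedZ c sx ∈ FP :=
  comp_mem_FP fstF_mem_FP (comp_mem_FP padTakeFn_mem_FP
    (fanoutFn_mem_FP (comp_mem_FP (seedRuler_mem_FP c sx) yZ_mem_FP)
      (comp_mem_FP lenBinF_mem_FP sndF_mem_FP)))

/-- `pow2NumF ∈ FP`. [folklore] -/
theorem pow2NumF_mem_FP : pow2NumF ∈ FP :=
  comp_mem_FP (append_mem_FP Kannan.zerosFn_mem_FP (const_mem_FP [true])) lenBinF_mem_FP

/-- `tableRulerZ ∈ FP`. [folklore] -/
theorem tableRulerZ_mem_FP : tableRulerZ ∈ FP :=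
  comp_mem_FP binToUnaryFn_mem_FP (fanoutFn_mem_FP PZ_mem_FP (comp_mem_FP pow2NumF_mem_FP yZ_mem_FP))

/-- `yOneZ ∈ FP`. [folklore] -/
theorem yOneZ_mem_FP : yOneZ ∈ FP :=
  comp_mem_FP appF_mem_FP (fanoutFn_mem_FP yZ_mem_FP (const_mem_FP _))

/-- `tableZ ∈ FP`. [folklore] -/
theorem tableZ_mem_FP : tableZ ∈ FP :=
  comp_mem_FP fstF_mem_FP (comp_mem_FP padTakeFn_mem_FP
    (fanoutFn_mem_FP tableRulerZ_mem_FP yOneZ_mem_FP))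

/-- `nbZ ∈ FP`. [folklore] -/
theorem nbZ_mem_FP : nbZ QN ∈ FP :=
  comp_mem_FP (polyFn_mem_FP QN) (fanoutFn_mem_FP xaZ_mem_FP umZ_mem_FP)

/-- `outZ ∈ FP` for `F ∈ FP`. [folklore] -/
theorem outZ_mem_FP (hF : F ∈ FP) : outZ F c sx QN ∈ FP :=
  comp_mem_FP hF (fanoutFn_mem_FP tableZ_mem_FP (fanoutFn_mem_FP (nbZ_mem_FP QN) (seedZ_mem_FP c sx)))

/-- `coinsZ ∈ FP` for `F ∈ FP`. [folklore] -/
theorem coinsZ_mem_FP (hF : F ∈ FP) : coinsZ F c sx QN ∈ FP :=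
  comp_mem_FP fstF_mem_FP (comp_mem_FP padTakeFn_mem_FP
    (fanoutFn_mem_FP umZ_mem_FP (outZ_mem_FP c sx QN hF)))

/-- `pieceZ ∈ FP` for `Ref ∈ P`, `F ∈ FP`. [folklore] -/
theorem pieceZ_mem_FP (hRef : Ref ∈ Classes.P) (hF : F ∈ FP) : pieceZ Ref F c sx QN ∈ FP :=
  comp_mem_FP (indicatorFn_mem_FP hRef) (fanoutFn_mem_FP xazZ_mem_FP (coinsZ_mem_FP c sx QN hF))

/-- `cntNumR ∈ FP`. [folklore] -/
theorem cntNumR_mem_FP : cntNumR c sx ∈ FP :=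
  comp_mem_FP (append_mem_FP Kannan.zerosFn_mem_FP (const_mem_FP [true]))
    (comp_mem_FP (seedRuler_mem_FP c sx) yR_mem_FP)

/-- `initR ∈ FP`. [folklore] -/
theorem initR_mem_FP : initR c sx ∈ FP :=
  fanoutFn_mem_FP (PolyTimeComputable.id _) (fanoutFn_mem_FP (cntNumR_mem_FP c sx) (const_mem_FP _))

/-- **`accR ∈ FP`**. [folklore] -/
theorem accR_mem_FP (hRef : Ref ∈ Classes.P) (hF : F ∈ FP) : accR Ref F c sx QN ∈ FP :=
  comp_mem_FP (sndPow_mem_FP 2)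
    (comp_mem_FP (foldLoop_clipF_mem_FP 1 addFn_mem_FP length_addFn_le
      (pieceZ_mem_FP c sx QN hRef hF) _) (initR_mem_FP c sx))

/-- `verdictR ∈ FP`. [folklore] -/
theorem verdictR_mem_FP (hRef : Ref ∈ Classes.P) (hF : F ∈ FP) : verdictR Ref F c sx QN ∈ FP :=
  comp_mem_FP ltFn_mem_FP (fanoutFn_mem_FP (cntNumR_mem_FP c sx)
    (comp_mem_FP addFn_mem_FP
      (fanoutFn_mem_FP (accR_mem_FP c sx QN hRef hF) (accR_mem_FP c sx QN hRef hF))))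

/-- **`postF ∈ FP`** for `Ref ∈ P`, `F ∈ FP`. [folklore] -/
theorem postF_mem_FP (hRef : Ref ∈ Classes.P) (hF : F ∈ FP) : postF Ref F c sx QN ∈ FP :=
  iteFn_mem_FP fstF_mem_FP (comp_mem_FP (verdictR_mem_FP c sx QN hRef hF) sndF_mem_FP) (const_mem_FP _)

/-! #### Values -/

variable (Ref F)
variable (P x α z U y : List Bool)

/-- The record. [folklore] -/
abbrev recR : List Bool := boolPair P (boolPair (boolPair (boolPair x α) z) (boolPair U y))

/-- Field `P` on a piece argument. [folklore] -/
@[simp] theorem PZ_rec (i : List Bool) : PZ (boolPair (recR P x α z U y) i) = P := by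
  simp [PZ, fstF]
/-- Field `⟨⟨x, α⟩, z⟩` on a piece argument. [folklore] -/
@[simp] theorem xazZ_rec (i : List Bool) :
    xazZ (boolPair (recR P x α z U y) i) = boolPair (boolPair x α) z := by
  simp [xazZ, gZ, fstF, sndF]
/-- Field `⟨x, α⟩` on a piece argument. [folklore] -/
@[simp] theorem xaZ_rec (i : List Bool) : xaZ (boolPair (recR P x α z U y) i) = boolPair x α := by
  simp [xaZ, xazZ, gZ, fstF, sndF]
/-- Field `U` on a piece argument. [folklore] -/
@[simp] theorem umZ_rec (i : List Bool) : umZ (boolPair (recR P x α z U y) i) = U := by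
  simp [umZ, gZ, fstF, sndF]
/-- Field `y` on a piece argument. [folklore] -/
@[simp] theorem yZ_rec (i : List Bool) : yZ (boolPair (recR P x α z U y) i) = y := by
  simp [yZ, gZ, fstF, sndF]
/-- The index on a piece argument. [folklore] -/
@[simp] theorem iZ_rec (i : List Bool) : iZ (boolPair (recR P x α z U y) i) = i := by simp [iZ, sndF]
/-- Field `y` on a record. [folklore] -/
@[simp] theorem yR_rec : yR (recR P x α z U y) = y := by simp [yR, sndF]

/-- **Value of the seed ruler**: `1^{σ}`, `σ = c ⌈log₂ (|y|+1)⌉^{sx} = MWSimQ.seedLen c sx y`.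
[cite: ImpagliazzoKabanetsWigderson2002, Thm. 11] -/
@[simp] theorem seedRuler_apply (w : List Bool) :
    seedRuler c sx w = ones (MWSimQ.seedLen c sx w) := by
  simp only [seedRuler, Function.comp_apply, lenBinF_apply, polyFn_apply, eval_pow, eval_X,
    TM2Pass.length_encodeNat_eq_size, natSize_eq_clog_succ, onesMulFn, ones, List.length_replicate,
    MWSimQ.seedLen]

/-- Value of `seedZ` in round `i`. [folklore] -/
theorem seedZ_rec (i : ℕ) :
    seedZ c sx (boolPair (recR P x α z U y) (ones i)) =
      List.takeD (MWSimQ.seedLen c sx y) (encodeNat i) false := by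
  simp [seedZ, ones]

/-- Value of `pow2NumF`: the numeral of `2^{Nat.size |w|}`. [folklore] -/
theorem pow2NumF_apply (w : List Bool) : pow2NumF w = encodeNat (2 ^ Nat.size w.length) := by
  simp [pow2NumF, TM2Pass.length_encodeNat_eq_size, Com.encodeNat_two_pow]

/-- Value of the table ruler on a long enough pad: `1^{2^M}`, `M = ⌈log₂ (|y|+1)⌉`. [folklore] -/
theorem tableRulerZ_rec (i : List Bool) (hP : 2 ^ Nat.clog 2 (y.length + 1) ≤ P.length) :
    tableRulerZ (boolPair (recR P x α z U y) i) = ones (2 ^ Nat.clog 2 (y.length + 1)) := by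
  simp only [tableRulerZ, Function.comp_apply, fanoutFn_apply, PZ_rec, yZ_rec, pow2NumF_apply,
    binToUnaryFn_boolPair, bitsToNat_encodeNat, natSize_eq_clog_succ, Nat.min_eq_left hP]

/-- **Value of the table**: `padTable y`. [cite: MurrayWilliams2018, §2] -/
theorem tableZ_rec (i : List Bool) (hP : 2 ^ Nat.clog 2 (y.length + 1) ≤ P.length) :
    tableZ (boolPair (recR P x α z U y) i) = padTable y := by
  have e : tableZ (boolPair (recR P x α z U y) i) =
      fstF (padTakeFn (boolPair (tableRulerZ (boolPair (recR P x α z U y) i))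
        (yOneZ (boolPair (recR P x α z U y) i)))) := by
    simp only [tableZ, Function.comp_apply, fanoutFn_apply]
  rw [e, tableRulerZ_rec P x α z U y i hP, padTakeFn_boolPair, fstF_boolPair, padTable_eq_takeD]
  simp [yOneZ, ones]

/-- The output length `nb = QN(|⟨⟨x, α⟩, U⟩|)`. [folklore] -/
abbrev nbOf : ℕ := QN.eval (boolPair (boolPair x α) U).length

/-- Value of `nbZ`. [folklore] -/
theorem nbZ_rec (i : List Bool) : nbZ QN (boolPair (recR P x α z U y) i) = ones (nbOf QN x α U) := by
  simp only [nbZ, Function.comp_apply, fanoutFn_apply, xaZ_rec, umZ_rec, polyFn_apply]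

/-- Value of `outZ` in round `i`. [folklore] -/
theorem outZ_rec (i : ℕ) (hP : 2 ^ Nat.clog 2 (y.length + 1) ≤ P.length) :
    outZ F c sx QN (boolPair (recR P x α z U y) (ones i)) =
      F (boolPair (padTable y) (boolPair (ones (nbOf QN x α U))
        (List.takeD (MWSimQ.seedLen c sx y) (encodeNat i) false))) := by
  simp only [outZ, Function.comp_apply, fanoutFn_apply, tableZ_rec P x α z U y _ hP,
    nbZ_rec, seedZ_rec]

/-- Value of `coinsZ` in round `i`. [folklore] -/
theorem coinsZ_rec (i : ℕ) (hP : 2 ^ Nat.clog 2 (y.length + 1) ≤ P.length) :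
    coinsZ F c sx QN (boolPair (recR P x α z U y) (ones i)) = List.takeD U.length
      (F (boolPair (padTable y) (boolPair (ones (nbOf QN x α U))
        (List.takeD (MWSimQ.seedLen c sx y) (encodeNat i) false)))) false := by
  simp only [coinsZ, Function.comp_apply, fanoutFn_apply, umZ_rec, outZ_rec F c sx QN P x α z U y i hP,
    padTakeFn_boolPair, fstF_boolPair]

/-- **Value of the piece of round `i`**: the bit `[⟨⟨⟨x, α⟩, z⟩, coinsᵢ⟩ ∈ Ref]`. [folklore] -/
theorem pieceZ_rec (i : ℕ) (hP : 2 ^ Nat.clog 2 (y.length + 1) ≤ P.length) :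
    pieceZ Ref F c sx QN (boolPair (recR P x α z U y) (ones i)) =
      [Ref.boolIndicator (boolPair (boolPair (boolPair x α) z) (List.takeD U.length
        (F (boolPair (padTable y) (boolPair (ones (nbOf QN x α U))
          (List.takeD (MWSimQ.seedLen c sx y) (encodeNat i) false)))) false))] := by
  simp only [pieceZ, Function.comp_apply, fanoutFn_apply, xazZ_rec,
    coinsZ_rec F c sx QN P x α z U y i hP]
  rfl

/-- The piece is one symbol long on every input. [folklore] -/
theorem length_pieceZ (w : List Bool) : (pieceZ Ref F c sx QN w).length = 1 := by
  simp [pieceZ, encodeBool]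

/-- Value of `cntNumR`: the numeral of `2^σ`. [folklore] -/
theorem cntNumR_rec : cntNumR c sx (recR P x α z U y) = encodeNat (2 ^ MWSimQ.seedLen c sx y) := by
  simp [cntNumR, ones, Com.encodeNat_two_pow]

/-- Value of `initR`. [folklore] -/
theorem initR_rec : initR c sx (recR P x α z U y) =
    boolPair (recR P x α z U y)
      (boolPair (encodeNat (2 ^ MWSimQ.seedLen c sx y)) (boolPair (ones 0) (encodeNat 0))) := by
  simp [initR, cntNumR_rec, ones]
  rfl

/-- **Value of `accR`** on a record whose pad is a long enough ruler (for the rounds and for the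
table): the numeral of `MWSim.accCount` at the table `padTable y`, seed length `MWSimQ.seedLen c sx y`,
output length `nb`, coin length `|U|`. [cite: AroraBarakCC2009, Lemma 20.3 (proof)] -/
theorem accR_rec (hPs : 2 ^ MWSimQ.seedLen c sx y ≤ P.length)
    (hPt : 2 ^ Nat.clog 2 (y.length + 1) ≤ P.length) :
    accR Ref F c sx QN (recR P x α z U y) = encodeNat
      (MWSim.accCount Ref F x α z (padTable y) (MWSimQ.seedLen c sx y) (nbOf QN x α U) U.length) := by
  have hk : 2 ^ MWSimQ.seedLen c sx y ≤ (X : Polynomial ℕ).eval (recR P x α z U y).length := by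
    rw [eval_X]
    refine hPs.trans ?_
    simp only [length_boolPair]; omega
  simp only [accR, Function.comp_apply, initR_rec]
  rw [foldLoop_apply addFn _ hk 0 (encodeNat 0), sndPow_succ_boolPair, sndPow_succ_boolPair,
    sndPow_zero_boolPair, foldAcc_clipF (fun i _ _ => by rw [length_pieceZ]; omega), foldAcc_addFn]
  have hb : ∀ b : Bool, bitsToNat [b] = b.toNat := fun b => by rw [bitsToNat_cons]; simp
  simp only [zero_add, MWSim.accCount, pieceZ_rec Ref F c sx QN P x α z U y _ hPt, hb,
    OracleCompose.unaryEncodeNat_eq_replicate, ones]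

/-- **Value of the verdict** on a record with a long enough pad: `[2^σ < 2 · accCount]`.
[cite: AroraBarakCC2009, Lemma 20.3 (proof)] -/
theorem verdictR_rec (hPs : 2 ^ MWSimQ.seedLen c sx y ≤ P.length)
    (hPt : 2 ^ Nat.clog 2 (y.length + 1) ≤ P.length) :
    verdictR Ref F c sx QN (recR P x α z U y) =
      [decide (2 ^ MWSimQ.seedLen c sx y < 2 * MWSim.accCount Ref F x α z (padTable y)
        (MWSimQ.seedLen c sx y) (nbOf QN x α U) U.length)] := by
  simp [verdictR, cntNumR_rec, accR_rec (hPs := hPs) (hPt := hPt), two_mul]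

/-- **Value of stage 4 on a rejected witness**: reject. [folklore] -/
theorem postF_false (R : List Bool) : postF Ref F c sx QN (boolPair [false] R) = [false] := by
  rw [postF, iteFn_apply_false (by simp [fstF])]

/-- **Value of stage 4 on an accepted witness** (pad long enough): the verdict. [folklore] -/
theorem postF_true (hPs : 2 ^ MWSimQ.seedLen c sx y ≤ P.length)
    (hPt : 2 ^ Nat.clog 2 (y.length + 1) ≤ P.length) :
    postF Ref F c sx QN (boolPair [true] (recR P x α z U y)) =
      [decide (2 ^ MWSimQ.seedLen c sx y < 2 * MWSim.accCount Ref F x α z (padTable y)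
        (MWSimQ.seedLen c sx y) (nbOf QN x α U) U.length)] := by
  rw [postF, iteFn_apply_true (by simp [fstF]), Function.comp_apply, sndF_boolPair,
    verdictR_rec (hPs := hPs) (hPt := hPt)]

end Post

/-! ### Stage 3: the preparation of the body

The body works on `⟨⟨pre X, P⟩, z'⟩`, `pre X = ⟨⟨x_h, 1^{T(n)}⟩, ⟨⟨x, 1^{m ℓ}⟩, β⟩⟩` the preprocessed
word of `MWSimN` (`MurrayWilliams2018SimulationMachine.lean`) and `P` the pad. -/

section Prep

/-- The preprocessed word `pre X` inside the body's input. [folklore] -/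
def preB : List Bool → List Bool := fstF ∘ fstF
/-- The pad `P`. [folklore] -/
def PB : List Bool → List Bool := sndF ∘ fstF
/-- The truncated witness `z'`. [folklore] -/
def zpB : List Bool → List Bool := sndF
/-- The field `x_h`. [folklore] -/
def xhB : List Bool → List Bool := fstF ∘ fstF ∘ preB
/-- The ruler `1^{T(n)}`. [folklore] -/
def utB : List Bool → List Bool := sndF ∘ fstF ∘ preB
/-- The word `⟨⟨x, 1^{m ℓ}⟩, β⟩`. [folklore] -/
def w0B : List Bool → List Bool := sndF ∘ preB
/-- The field `x`. [folklore] -/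
def xB : List Bool → List Bool := fstF ∘ fstF ∘ w0B
/-- The ruler `1^{m ℓ}`. [folklore] -/
def umB : List Bool → List Bool := sndF ∘ fstF ∘ w0B
/-- The field `α`. [folklore] -/
def alphaB : List Bool → List Bool := sndF ∘ fstF ∘ sndF ∘ w0B
/-- **The hard witness** `y = (fst z') ↾ T(n)` (cut to the admissible length of `V`). [folklore] -/
def yB : List Bool → List Bool := takeFn ∘ fanoutFn utB (fstF ∘ zpB)
/-- **Merlin's message** `z = takeD (m ℓ) (snd z')` (normalised to the move length). [folklore] -/
def zB : List Bool → List Bool := fstF ∘ padTakeFn ∘ fanoutFn umB (sndF ∘ zpB)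

/-- **Stage 3**: `⟨⟨pre X, P⟩, z'⟩ ↦ ⟨⟨x_h, y⟩, ⟨P, ⟨⟨⟨x, α⟩, z⟩, ⟨1^{m ℓ}, y⟩⟩⟩⟩` — the pair for the
verifier `V` in front, the verdict's record behind. [folklore] -/
def bodyPrepF : List Bool → List Bool :=
  fanoutFn (fanoutFn xhB yB)
    (fanoutFn PB (fanoutFn (fanoutFn (fanoutFn xB alphaB) zB) (fanoutFn umB yB)))

/-- `bodyPrepF ∈ FP`. [folklore] -/
theorem prepF_mem_FP : bodyPrepF ∈ FP := by
  have hpre : preB ∈ FP := comp_mem_FP fstF_mem_FP fstF_mem_FP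
  have hP : PB ∈ FP := comp_mem_FP sndF_mem_FP fstF_mem_FP
  have hw0 : w0B ∈ FP := comp_mem_FP sndF_mem_FP hpre
  have hxh : xhB ∈ FP := comp_mem_FP fstF_mem_FP (comp_mem_FP fstF_mem_FP hpre)
  have hut : utB ∈ FP := comp_mem_FP sndF_mem_FP (comp_mem_FP fstF_mem_FP hpre)
  have hx : xB ∈ FP := comp_mem_FP fstF_mem_FP (comp_mem_FP fstF_mem_FP hw0)
  have hum : umB ∈ FP := comp_mem_FP sndF_mem_FP (comp_mem_FP fstF_mem_FP hw0)
  have hα : alphaB ∈ FP :=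
    comp_mem_FP sndF_mem_FP (comp_mem_FP fstF_mem_FP (comp_mem_FP sndF_mem_FP hw0))
  have hy : yB ∈ FP :=
    comp_mem_FP takeFn_mem_FP (fanoutFn_mem_FP hut (comp_mem_FP fstF_mem_FP sndF_mem_FP))
  have hz : zB ∈ FP := comp_mem_FP fstF_mem_FP (comp_mem_FP padTakeFn_mem_FP
    (fanoutFn_mem_FP hum (comp_mem_FP sndF_mem_FP sndF_mem_FP)))
  exact fanoutFn_mem_FP (fanoutFn_mem_FP hxh hy)
    (fanoutFn_mem_FP hP (fanoutFn_mem_FP (fanoutFn_mem_FP (fanoutFn_mem_FP hx hα) hz)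
      (fanoutFn_mem_FP hum hy)))

variable (xh UT x Um β P zp : List Bool)

/-- The body's input for the preprocessed word with the displayed fields, the pad and the
witness. [folklore] -/
abbrev bodyIn : List Bool :=
  boolPair (boolPair (boolPair (boolPair xh UT) (boolPair (boolPair x Um) β)) P) zp

/-- **Value of stage 3.** [folklore] -/
theorem prepF_bodyIn : bodyPrepF (bodyIn xh UT x Um β P zp) =
    boolPair (boolPair xh ((fstF zp).take UT.length))
      (recR P x (sndF (fstF β)) (List.takeD Um.length (sndF zp) false) Um
        ((fstF zp).take UT.length)) := by
  simp [bodyPrepF, xhB, utB, xB, umB, alphaB, yB, zB, w0B, preB, PB, zpB, fstF, sndF]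

end Prep

/-! ### The body: preparation, the verifier `V` on `⟨x_h, y⟩`, the verdict -/

section Body

variable (Ref : Language Bool) (F : List Bool → List Bool) (c sx : ℕ) (QN : Polynomial ℕ)

/-- **The output of the body** on the advised input `X`, the pad `P` and the (truncated) witness
`z'`: stage 4 applied to the verifier's bit on `⟨x_h, y⟩`, `y = (fst z') ↾ T(n)`, and the record.
[folklore] -/
def bodyOut (t m : ℕ → ℕ) {L : Language Bool} (V : NVerifier t L) (X P zp : List Bool) :
    List Bool :=
  postF Ref F c sx QN (boolPair (encodeBool (V.rel (MWSimN.xhIn X)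
    ((fstF zp).take (MWSimN.wlen t V.c X))))
    (recR P (MWSimN.xIn X) (MWSimN.alphaIn X) (List.takeD (m (MWSimN.xIn X).length) (sndF zp) false)
      (ones (m (MWSimN.xIn X).length)) ((fstF zp).take (MWSimN.wlen t V.c X))))

variable {Ref F}

/-- **The body machine** `M_prep ∘ mapFstAux V.machine ∘ M_post` on `⟨⟨pre X, P⟩, z'⟩`: it outputs
`bodyOut` within `Q(|⟨⟨pre X, P⟩, z'⟩|) + (c_V t(n) + c_V)` steps — the hard witness handed to `V`
is cut to its admissible length, so `V`'s own time bound applies (the argument of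
`MWSimN.exists_body_machine`). [folklore] -/
theorem exists_body_machine (hRef : Ref ∈ Classes.P) (hF : F ∈ FP) :
    ∃ Q : Polynomial ℕ, ∀ (t m : ℕ → ℕ) {L : Language Bool} (V : NVerifier t L),
      ∃ S : TM2ComputableAux Bool Bool, ∀ X P zp : List Bool,
      S.OutputsWithin (boolPair (boolPair (MWSimN.pre t m V.c X) P) zp)
        (bodyOut Ref F c sx QN t m V X P zp)
        (Q.eval (boolPair (boolPair (MWSimN.pre t m V.c X) P) zp).length +
          (V.c * t (MWSimN.xhIn X).length + V.c)) := by
  obtain ⟨p₃, M₃, hM₃⟩ := prepF_mem_FP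
  obtain ⟨p₄, M₄, hM₄⟩ := postF_mem_FP c sx QN hRef hF
  set D₃ := TM2Comp.machinePushBound M₃.tm with hD₃
  set Lp : Polynomial ℕ := X + Polynomial.C D₃ * p₃ with hLp
  refine ⟨p₃ + 3 + 2 * Lp + 6 + p₄.comp (4 + Lp), fun t m L V =>
    ⟨M₃.comp ((mapFstAux V.machine).comp M₄), fun Xw P zp => ?_⟩⟩
  set Bw := boolPair (boolPair (MWSimN.pre t m V.c Xw) P) zp with hBw
  set xh := MWSimN.xhIn Xw with hxh
  set y := (fstF zp).take (MWSimN.wlen t V.c Xw) with hy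
  set R := recR P (MWSimN.xIn Xw) (MWSimN.alphaIn Xw)
    (List.takeD (m (MWSimN.xIn Xw).length) (sndF zp) false) (ones (m (MWSimN.xIn Xw).length)) y
    with hR
  -- stage 3
  have h₁ : M₃.OutputsWithin Bw (bodyPrepF Bw) (p₃.eval Bw.length) := hM₃ Bw
  have hℓ₁ : (bodyPrepF Bw).length ≤ Bw.length + D₃ * p₃.eval Bw.length :=
    TM2Comp.length_le_of_outputsWithin M₃ h₁
  have hpre : bodyPrepF Bw = boolPair (boolPair xh y) R := by
    rw [hBw, MWSimN.pre, prepF_bodyIn]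
    simp only [ones, List.length_replicate]
    rfl
  -- the verifier under `mapFstAux`
  have hylen : y.length ≤ V.c * t xh.length + V.c := by
    rw [hy]; exact (List.length_take_le _ _).trans le_rfl
  have hV : V.machine.OutputsWithin (boolUnpair (bodyPrepF Bw)).1 (encodeBool (V.rel xh y))
      (V.c * t xh.length + V.c) := by
    rw [hpre, boolUnpair_boolPair]
    exact V.outputsWithin xh y hylen
  have h₂ := outputsWithin_mapFstAux V.machine hV
  rw [hpre, readRest_boolPair] at h₂
  rw [← hpre] at h₂
  -- stage 4
  set mid := boolPair (encodeBool (V.rel xh y)) R with hmid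
  have h₃ : M₄.OutputsWithin mid (postF Ref F c sx QN mid) (p₄.eval mid.length) := hM₄ mid
  have hval : postF Ref F c sx QN mid = bodyOut Ref F c sx QN t m V Xw P zp := by
    rw [hmid, bodyOut, ← hxh, ← hy]
  rw [hval] at h₃
  have h := Turing.TM2ComputableAux.comp_outputsWithin _ _ h₁
    (Turing.TM2ComputableAux.comp_outputsWithin _ _ h₂ h₃)
  refine h.mono ?_
  -- bookkeeping in `Z = |Bw|`
  have hL : (bodyPrepF Bw).length ≤ Lp.eval Bw.length := by
    simp only [hLp, eval_add, eval_X, eval_mul, eval_C]; exact hℓ₁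
  have hRle : R.length ≤ (bodyPrepF Bw).length := by
    rw [hpre]; simp only [length_boolPair]; omega
  have hb : (encodeBool (V.rel xh y)).length = 1 := by cases V.rel xh y <;> rfl
  have hmidl : mid.length ≤ (4 + Lp).eval Bw.length := by
    rw [hmid, length_boolPair, hb]
    simp only [eval_add, eval_ofNat]
    omega
  have hpG : p₄.eval mid.length ≤ (p₄.comp (4 + Lp)).eval Bw.length := by
    rw [eval_comp]; exact TM2Iter.eval_mono _ hmidl
  simp only [eval_add, eval_mul, eval_ofNat]
  rw [hb]
  omega

end Body

/-! ### Stage 1: the clocks and the exponential pad -/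

section Clock

variable (c sx : ℕ)

/-- **The pad exponent** at admissible witness length `T`: `σ* = c ⌈log₂ (T+1)⌉^{sx} + ⌈log₂ (T+1)⌉`
— at least the seed length `c ⌈log₂ (|y|+1)⌉^{sx}` and the table scale `⌈log₂ (|y|+1)⌉` of every
witness `y` with `|y| ≤ T`. [folklore] -/
def sigMax (T : ℕ) : ℕ := c * Nat.clog 2 (T + 1) ^ sx + Nat.clog 2 (T + 1)

/-- The pad exponent dominates the seed length of a shorter witness. [folklore] -/
theorem seedLen_le_sigMax {y : List Bool} {T : ℕ} (h : y.length ≤ T) :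
    MWSimQ.seedLen c sx y ≤ sigMax c sx T := by
  rw [MWSimQ.seedLen, sigMax]
  have hc : Nat.clog 2 (y.length + 1) ≤ Nat.clog 2 (T + 1) := Nat.clog_mono_right 2 (by omega)
  exact (Nat.mul_le_mul_left c (Nat.pow_le_pow_left hc sx)).trans (Nat.le_add_right _ _)

/-- The pad exponent dominates the table scale of a shorter witness. [folklore] -/
theorem clog_le_sigMax {y : List Bool} {T : ℕ} (h : y.length ≤ T) :
    Nat.clog 2 (y.length + 1) ≤ sigMax c sx T := by
  rw [sigMax]
  exact (Nat.clog_mono_right 2 (by omega : y.length + 1 ≤ T + 1)).trans (Nat.le_add_left _ _)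

/-- **The pad** `1^{2^{σ*} + 1}`. [folklore] -/
def padOf (T : ℕ) : List Bool := ones (2 ^ sigMax c sx T + 1)

/-- Length of the pad. [folklore] -/
@[simp] theorem length_padOf (T : ℕ) : (padOf c sx T).length = 2 ^ sigMax c sx T + 1 := by
  simp [padOf, ones]

/-- The pad is long enough for the rounds of a shorter witness. [folklore] -/
theorem two_pow_seedLen_le_padOf {y : List Bool} {T : ℕ} (h : y.length ≤ T) :
    2 ^ MWSimQ.seedLen c sx y ≤ (padOf c sx T).length := by
  rw [length_padOf]
  exact (Nat.pow_le_pow_right two_pos (seedLen_le_sigMax c sx h)).trans (Nat.le_succ _)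

/-- The pad is a long enough ruler for the table of a shorter witness. [folklore] -/
theorem two_pow_clog_le_padOf {y : List Bool} {T : ℕ} (h : y.length ≤ T) :
    2 ^ Nat.clog 2 (y.length + 1) ≤ (padOf c sx T).length := by
  rw [length_padOf]
  exact (Nat.pow_le_pow_right two_pos (clog_le_sigMax c sx h)).trans (Nat.le_succ _)

/-- The ruler of the pad exponent: `w ↦ 1^{σ*(|w|)}` (`seedRuler` and the unary bit length).
[folklore] -/
def sigRuler : List Bool → List Bool := appF ∘ fanoutFn (seedRuler c sx) (onesFn ∘ lenBinF)

/-- `sigRuler ∈ FP`. [folklore] -/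
theorem sigRuler_mem_FP : sigRuler c sx ∈ FP :=
  comp_mem_FP appF_mem_FP
    (fanoutFn_mem_FP (seedRuler_mem_FP c sx) (comp_mem_FP onesFn_mem_FP lenBinF_mem_FP))

/-- Value of `sigRuler`. [folklore] -/
@[simp] theorem sigRuler_apply (w : List Bool) : sigRuler c sx w = ones (sigMax c sx w.length) := by
  simp only [sigRuler, Function.comp_apply, fanoutFn_apply, seedRuler_apply, appF_boolPair,
    lenBinF_apply, onesFn, OracleCompose.unaryEncodeNat_eq_replicate,
    TM2Pass.length_encodeNat_eq_size, natSize_eq_clog_succ, MWSimQ.seedLen, sigMax, ones,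
    ← List.replicate_add]

variable (t m : ℕ → ℕ) (cV : ℕ)

/-- **The padded preprocessed word** `preQ X = ⟨pre X, 1^{2^{σ*}+1}⟩`, `σ*` at the admissible
witness length `T(n) = c_V t(n) + c_V` of `V` at the bad input (`MWSimN.wlen`). [folklore] -/
def preQ (X : List Bool) : List Bool :=
  boolPair (MWSimN.pre t m cV X) (padOf c sx (MWSimN.wlen t cV X))

/-- Between the clocks of `MWSimN` and the exponential clock: `W = ⟨pre X, 1^{win}⟩ ↦ ⟨1^{σ*}, W⟩`
(the pad exponent read off the ruler `1^{T(n)}` inside `pre X`). [folklore] -/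
def expoQF : List Bool → List Bool := fanoutFn (sigRuler c sx ∘ sndF ∘ fstF ∘ fstF) fun w => w

/-- After the exponential clock: `⟨⟨1^{σ*}, P⟩, ⟨pre X, 1^{win}⟩⟩ ↦ ⟨⟨pre X, P⟩, 1^{win}⟩`. [folklore] -/
def arrQF : List Bool → List Bool :=
  fanoutFn (fanoutFn (fstF ∘ sndF) (sndF ∘ fstF)) (sndF ∘ sndF)

/-- `expoQF ∈ FP`. [folklore] -/
theorem expoQF_mem_FP : expoQF c sx ∈ FP :=
  fanoutFn_mem_FP (comp_mem_FP (sigRuler_mem_FP c sx)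
    (comp_mem_FP sndF_mem_FP (comp_mem_FP fstF_mem_FP fstF_mem_FP))) (PolyTimeComputable.id _)

/-- `arrQF ∈ FP`. [folklore] -/
theorem arrQF_mem_FP : arrQF ∈ FP :=
  fanoutFn_mem_FP (fanoutFn_mem_FP (comp_mem_FP fstF_mem_FP sndF_mem_FP)
    (comp_mem_FP sndF_mem_FP fstF_mem_FP)) (comp_mem_FP sndF_mem_FP sndF_mem_FP)

/-- Value of `expoQF` on the clocked word of `MWSimN`. [folklore] -/
theorem expoQF_apply (X : List Bool) (win : List Bool) :
    expoQF c sx (boolPair (MWSimN.pre t m cV X) win) =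
      boolPair (ones (sigMax c sx (MWSimN.wlen t cV X))) (boolPair (MWSimN.pre t m cV X) win) := by
  simp only [expoQF, fanoutFn_apply, Function.comp_apply, MWSimN.pre, fstF_boolPair, sndF_boolPair,
    sigRuler_apply, ones, List.length_replicate]

/-- Value of `arrQF`. [folklore] -/
theorem arrQF_apply (e Pd W win : List Bool) :
    arrQF (boolPair (boolPair e Pd) (boolPair W win)) = boolPair (boolPair W Pd) win := by
  simp [arrQF, fstF_boolPair, sndF_boolPair]

/-- **The clock stage** on EVERY word `X`: the two unary clocks of `MWSimN`
(`MWSimN.exists_clock_machine`: `X ↦ ⟨pre X, 1^{window X}⟩`), the pad exponent, the exponential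
clock `expClock 1 1` under `mapFstAux` (`1^{σ*} ↦ ⟨1^{σ*}, 1^{2^{σ*}+1}⟩`), and the rearrangement; it
outputs `⟨preQ X, 1^{window X}⟩` within `C · P₁(|X| + m ℓ + T(n) + 2^{σ*})` steps.
[cite: AroraBarakCC2009, §1.3] -/
theorem exists_clock_machine :
    ∃ P₁ : Polynomial ℕ, ∀ (t m : ℕ → ℕ) (cV : ℕ), IsTimeConstructible m → IsTimeConstructible t →
      1 ≤ cV → ∃ (C : ℕ) (N : TM2ComputableAux Bool Bool), ∀ X : List Bool,
      N.OutputsWithin X (boolPair (preQ c sx t m cV X) (List.replicate (MWSimN.window t m cV X) true))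
        (C * P₁.eval (X.length + m (MWSimN.xIn X).length + MWSimN.wlen t cV X +
          2 ^ sigMax c sx (MWSimN.wlen t cV X))) := by
  obtain ⟨P₀, hP₀⟩ := MWSimN.exists_clock_machine
  obtain ⟨pE, ME, hME⟩ := expoQF_mem_FP c sx
  obtain ⟨C₁, Ck, hCk⟩ := exists_timeComputable_expClock 1 (k := 1) le_rfl
  obtain ⟨pA, MA, hMA⟩ := arrQF_mem_FP
  refine ⟨P₀ + pE.comp (26 * X + 28) + (Polynomial.C C₁ * X + Polynomial.C C₁ + 70 * X + 80) +
      pA.comp (70 * X + 80), fun t m cV hm ht hcV => ?_⟩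
  obtain ⟨C₀, N₀, hN₀⟩ := hP₀ t m cV hm ht hcV
  refine ⟨C₀ + 1, N₀.comp (ME.comp ((mapFstAux Ck).comp MA)), fun Xw => ?_⟩
  set Λ := Xw.length + m (MWSimN.xIn Xw).length + MWSimN.wlen t cV Xw with hΛ
  set e := sigMax c sx (MWSimN.wlen t cV Xw) with he
  obtain ⟨I, hI⟩ : ∃ I : ℕ, I = 2 ^ e := ⟨_, rfl⟩
  set W := boolPair (MWSimN.pre t m cV Xw) (List.replicate (MWSimN.window t m cV Xw) true) with hW
  -- the clocks of `MWSimN`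
  have h₀ : N₀.OutputsWithin Xw W (C₀ * P₀.eval Λ) := hN₀ Xw
  -- the pad exponent
  have h₁ : ME.OutputsWithin W (boolPair (ones e) W) (pE.eval W.length) := by
    have := hME W
    rwa [hW, expoQF_apply, ← hW] at this
  -- the exponential clock under `mapFstAux`
  have hclk : Ck.OutputsWithin (boolUnpair (boolPair (ones e) W)).1
      (boolPair (ones e) (ones (I + 1))) (C₁ * I + C₁) := by
    rw [boolUnpair_boolPair, hI]
    have h := hCk (ones e)
    simp only [expClock, id, one_mul, pow_one, ones, List.length_replicate] at h
    simpa only [ones, pow_one] using h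
  have h₂ := outputsWithin_mapFstAux Ck hclk
  rw [readRest_boolPair] at h₂
  -- the rearrangement
  set Z := boolPair (boolPair (ones e) (ones (I + 1))) W with hZ
  have h₃ : MA.OutputsWithin Z (arrQF Z) (pA.eval Z.length) := hMA Z
  have hval : arrQF Z = boolPair (boolPair (MWSimN.pre t m cV Xw) (ones (I + 1)))
      (List.replicate (MWSimN.window t m cV Xw) true) := by
    rw [hZ, hW, arrQF_apply]
  rw [hval] at h₃
  have h := Turing.TM2ComputableAux.comp_outputsWithin _ _ h₀
    (Turing.TM2ComputableAux.comp_outputsWithin _ _ h₁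
      (Turing.TM2ComputableAux.comp_outputsWithin _ _ h₂ h₃))
  have hpreQ : boolPair (MWSimN.pre t m cV Xw) (ones (I + 1)) = preQ c sx t m cV Xw := by
    rw [preQ, padOf, hI, he]
  rw [hpreQ] at h
  refine h.mono ?_
  rw [← hI]
  have heI : e ≤ I := by rw [hI]; exact (Nat.lt_two_pow_self).le
  clear hI hval hpreQ h h₀ h₁ h₂ h₃ hclk
  -- bookkeeping in `Y = Λ + 2^e`
  set Y := Λ + I with hY
  have hpreL : (MWSimN.pre t m cV Xw).length ≤ 12 * Λ + 12 := by
    simp only [MWSimN.pre, length_boolPair, ones, List.length_replicate]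
    have := MWSimN.length_advIn_le Xw
    have := MWSimN.length_xhIn_le Xw
    have := MWSimN.length_xIn_le Xw
    omega
  have hwin : MWSimN.window t m cV Xw ≤ 2 * Λ + 2 := by simp only [MWSimN.window]; omega
  have hWl : W.length ≤ 26 * Y + 28 := by
    rw [hW, length_boolPair, List.length_replicate]; omega
  have hL₁ : (boolPair (ones e) W).length = 2 * e + 2 + W.length := by
    simp only [length_boolPair, ones, List.length_replicate]
  have hL₂ : (boolPair (ones e) (ones (I + 1))).length = 2 * e + 2 + (I + 1) := by
    simp only [length_boolPair, ones, List.length_replicate]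
  have hL₃ : Z.length = 2 * (2 * e + 2 + (I + 1)) + 2 + W.length := by
    rw [hZ, length_boolPair, hL₂]
  have heY : e ≤ Y := heI.trans (Nat.le_add_left _ _)
  have h2e : I ≤ Y := Nat.le_add_left _ _
  have hΛY : Λ ≤ Y := Nat.le_add_right _ _
  have hP₀ : P₀.eval Λ ≤ P₀.eval Y := TM2Iter.eval_mono _ hΛY
  have hpE : pE.eval W.length ≤ (pE.comp (26 * X + 28)).eval Y := by
    rw [eval_comp]; exact TM2Iter.eval_mono _ (by simp only [eval_add, eval_mul, eval_ofNat, eval_X]; exact hWl)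
  have hZl : Z.length ≤ 70 * Y + 80 := by rw [hL₃]; omega
  have hpA : pA.eval Z.length ≤ (pA.comp (70 * X + 80)).eval Y := by
    rw [eval_comp]; exact TM2Iter.eval_mono _ (by simp only [eval_add, eval_mul, eval_ofNat, eval_X]; exact hZl)
  have hC1 : C₁ * I ≤ C₁ * Y := Nat.mul_le_mul_left _ h2e
  rw [hL₂, hL₁] at *
  simp only [eval_add, eval_mul, eval_C, eval_X, eval_ofNat]
  have e1 : (C₀ + 1) * (P₀.eval Y + (pE.comp (26 * X + 28)).eval Y + (C₁ * Y + C₁ + 70 * Y + 80) +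
      (pA.comp (70 * X + 80)).eval Y) = C₀ * P₀.eval Y + C₀ * ((pE.comp (26 * X + 28)).eval Y +
        (C₁ * Y + C₁ + 70 * Y + 80) + (pA.comp (70 * X + 80)).eval Y) + (P₀.eval Y +
          (pE.comp (26 * X + 28)).eval Y + (C₁ * Y + C₁ + 70 * Y + 80) + (pA.comp (70 * X + 80)).eval Y) := by
    ring
  rw [e1]
  have hz : 0 ≤ C₀ * ((pE.comp (26 * X + 28)).eval Y + (C₁ * Y + C₁ + 70 * Y + 80) +
      (pA.comp (70 * X + 80)).eval Y) := Nat.zero_le _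
  have hm0 : C₀ * P₀.eval Λ ≤ C₀ * P₀.eval Y := Nat.mul_le_mul_left _ hP₀
  omega

end Clock

/-! ### The simulating pair language and its nondeterministic time -/

section Language

variable (Ref : Language Bool) (F : List Bool → List Bool) (c sx : ℕ) (QN : Polynomial ℕ)

/-- The output length read by the machine at `(x, α)` and move length `m ℓ`:
`nb = QN(|⟨⟨x, α⟩, 1^{m ℓ}⟩|)`, as a function of `|x|` and `|α|` (the shape `Nb` of
`MWSimQ.verdictBit`). [folklore] -/
def nbLen (m : ℕ → ℕ) (ℓ A : ℕ) : ℕ := QN.eval (2 * (2 * ℓ + 2 + A) + 2 + m ℓ)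

/-- `nbOf` at `U = 1^{m ℓ}` is `nbLen`. [folklore] -/
theorem nbOf_ones (m : ℕ → ℕ) (x α : List Bool) :
    nbOf QN x α (ones (m x.length)) = nbLen QN m x.length α.length := by
  simp only [nbOf, nbLen, length_boolPair, ones, List.length_replicate]

/-- **The behaviour of the simulating verifier** on the advised input `X` and the (truncated)
witness `z'`: the hard witness `y = (fst z') ↾ T(n)` must be accepted by `V` on the bad input `x_h`,
and then a majority of the `2^{c M^{sx}}` seeds must make Arthur accept
`⟨⟨⟨x, α⟩, z⟩, G_{padTable y}(ρᵢ) ↾ m ℓ⟩`, `z = takeD (m ℓ) (snd z')` (`MWSim.accCount`). [folklore] -/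
def verdictBit (t m : ℕ → ℕ) {L : Language Bool} (V : NVerifier t L) (X zp : List Bool) : Bool :=
  V.rel (MWSimN.xhIn X) ((fstF zp).take (MWSimN.wlen t V.c X)) &&
    decide (2 ^ MWSimQ.seedLen c sx ((fstF zp).take (MWSimN.wlen t V.c X)) <
      2 * MWSim.accCount Ref F (MWSimN.xIn X) (MWSimN.alphaIn X)
        (List.takeD (m (MWSimN.xIn X).length) (sndF zp) false)
        (padTable ((fstF zp).take (MWSimN.wlen t V.c X)))
        (MWSimQ.seedLen c sx ((fstF zp).take (MWSimN.wlen t V.c X)))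
        (nbLen QN m (MWSimN.xIn X).length (MWSimN.alphaIn X).length) (m (MWSimN.xIn X).length))

/-- **The simulating pair language** `N'`: advised inputs `X = ⟨x, β⟩` having a witness inside the
window on which the simulating verifier accepts. [folklore] -/
def simLang (t m : ℕ → ℕ) {L : Language Bool} (V : NVerifier t L) : Language Bool :=
  {X | ∃ zp : List Bool, zp.length ≤ MWSimN.window t m V.c X ∧
    verdictBit Ref F c sx QN t m V X zp = true}

/-- **The body computes the verdict**: with the genuine pad, the output of the body on `(X, z')`
is the one-symbol string of `verdictBit` (the pad is long enough for the `2^σ` rounds and for the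
table of the cut witness, `two_pow_seedLen_le_padOf`, `two_pow_clog_le_padOf`). [folklore] -/
theorem bodyOut_padOf (t m : ℕ → ℕ) {L : Language Bool} (V : NVerifier t L) (X zp : List Bool) :
    bodyOut Ref F c sx QN t m V X (padOf c sx (MWSimN.wlen t V.c X)) zp =
      [verdictBit Ref F c sx QN t m V X zp] := by
  rw [bodyOut, verdictBit]
  set y := (fstF zp).take (MWSimN.wlen t V.c X) with hy
  have hyl : y.length ≤ MWSimN.wlen t V.c X := List.length_take_le _ _
  cases V.rel (MWSimN.xhIn X) y with
  | false => rw [show encodeBool false = [false] from rfl, postF_false, Bool.false_and]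
  | true =>
    rw [show encodeBool true = [true] from rfl,
      postF_true Ref F c sx QN _ _ _ _ _ _ (two_pow_seedLen_le_padOf c sx hyl)
        (two_pow_clog_le_padOf c sx hyl), Bool.true_and, nbOf_ones]
    simp only [ones, List.length_replicate]

/-- **On well-formed words the machine's verdict is `MWSimQ.verdictBit`** with the window
`MWSimN.window`, the move length `m` and the output lengths `nbLen`: for `w = ⟨x, ⟨⟨x_h, α⟩, j⟩⟩`
and `|z'| ≤ window w`. [folklore] -/
theorem verdictBit_word (t m : ℕ → ℕ) {L : Language Bool} (V : NVerifier t L)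
    (x xh α j zp : List Bool)
    (hzp : zp.length ≤ MWSimN.window t m V.c (boolPair x (boolPair (boolPair xh α) j))) :
    verdictBit Ref F c sx QN t m V (boolPair x (boolPair (boolPair xh α) j)) zp =
      MWSimQ.verdictBit t V Ref F c sx m (nbLen QN m) (MWSimN.window t m V.c)
        (boolPair x (boolPair (boolPair xh α) j)) zp := by
  rw [verdictBit, MWSimQ.verdictBit, List.take_of_length_le hzp]
  simp only [MWSimN.xhIn_boolPair, MWSimN.xIn_boolPair, MWSimN.alphaIn_boolPair, MWSimQ.xhOf_word,
    MWSimQ.xOf_word, MWSimQ.alphaOf_word, MWSim.witOf, MWSim.bound, MWSimN.wlen]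

/-- **Membership of well-formed words**: `⟨x, ⟨⟨x_h, α⟩, j⟩⟩ ∈ simLang` iff it is in
`MWSimQ.simLang` (same parameters), so that the correctness theorems of
`MurrayWilliams2018SimulationQ.lean` apply to the machine's language. [folklore] -/
theorem mem_simLang_iff_word (t m : ℕ → ℕ) {L : Language Bool} (V : NVerifier t L)
    (x xh α j : List Bool) :
    boolPair x (boolPair (boolPair xh α) j) ∈ simLang Ref F c sx QN t m V ↔
      boolPair x (boolPair (boolPair xh α) j) ∈
        MWSimQ.simLang t V Ref F c sx m (nbLen QN m) (MWSimN.window t m V.c) := by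
  constructor
  · rintro ⟨zp, hzp, h⟩
    exact ⟨zp, hzp, by rwa [← verdictBit_word Ref F c sx QN t m V x xh α j zp hzp]⟩
  · rintro ⟨zp, hzp, h⟩
    exact ⟨zp, hzp, by rwa [verdictBit_word Ref F c sx QN t m V x xh α j zp hzp]⟩

/-! #### Arithmetic of the cost -/

/-- `2^a + 2^b ≤ 2^{a+b+1}`. [folklore] -/
theorem two_pow_add_two_pow_le (a b : ℕ) : 2 ^ a + 2 ^ b ≤ 2 ^ (a + b + 1) := by
  have ha : 2 ^ a ≤ 2 ^ (a + b) := Nat.pow_le_pow_right two_pos (Nat.le_add_right _ _)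
  have hb : 2 ^ b ≤ 2 ^ (a + b) := Nat.pow_le_pow_right two_pos (Nat.le_add_left _ _)
  rw [pow_succ]; omega

/-- The scale of the admissible witness length is logarithmic in `t`:
`T ≤ c_V u + c_V ⟹ ⌈log₂ (T+1)⌉ ≤ log₂ u + 2 + size (c_V + 1)`. [folklore] -/
theorem clog_succ_le_of_le (T u cV : ℕ) (h : T ≤ cV * u + cV) :
    Nat.clog 2 (T + 1) ≤ Nat.log 2 u + 2 + Nat.size (cV + 1) := by
  rw [Nat.clog_le_iff_le_pow one_lt_two]
  have h1 : cV + 1 ≤ 2 ^ Nat.size (cV + 1) := (Nat.lt_size_self _).le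
  have h2 : u + 1 ≤ 2 ^ (Nat.log 2 u + 1) := Nat.lt_pow_succ_log_self one_lt_two u
  calc T + 1 ≤ (cV + 1) * (u + 1) := by nlinarith
    _ ≤ 2 ^ Nat.size (cV + 1) * 2 ^ (Nat.log 2 u + 1) := Nat.mul_le_mul h1 h2
    _ = 2 ^ (Nat.log 2 u + 1 + Nat.size (cV + 1)) := by rw [← pow_add, Nat.add_comm]
    _ ≤ 2 ^ (Nat.log 2 u + 2 + Nat.size (cV + 1)) := Nat.pow_le_pow_right two_pos (by omega)

/-- **The polylogarithmic seed is absorbed by the next power of the logarithm**: for all `K, cv`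
and `sx ≥ 1` there is `D` with `2^{K (L + cv)^{sx}} ≤ 2^{(sx+1) L^{sx+1}} + D` for every `L`
(beyond `L₀ = cv + K 2^{sx}` the exponent is dominated; below, the left side is bounded). [folklore] -/
theorem exists_two_pow_mul_pow_le (K cv sx : ℕ) :
    ∃ D : ℕ, ∀ L : ℕ, 2 ^ (K * (L + cv) ^ sx) ≤ 2 ^ ((sx + 1) * L ^ (sx + 1)) + D := by
  set L₀ := cv + K * 2 ^ sx with hL₀
  refine ⟨2 ^ (K * (L₀ + cv) ^ sx), fun L => ?_⟩
  rcases le_or_gt L L₀ with hL | hL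
  · exact le_add_left (Nat.pow_le_pow_right two_pos
      (Nat.mul_le_mul_left K (Nat.pow_le_pow_left (by omega) sx)))
  · refine le_add_right (Nat.pow_le_pow_right two_pos ?_)
    have hcv : cv ≤ L := by omega
    have hK : K * 2 ^ sx ≤ L := by omega
    calc K * (L + cv) ^ sx ≤ K * (2 * L) ^ sx := Nat.mul_le_mul_left K (Nat.pow_le_pow_left (by omega) sx)
      _ = K * 2 ^ sx * L ^ sx := by rw [mul_pow, mul_assoc]
      _ ≤ L * L ^ sx := Nat.mul_le_mul_right _ hK
      _ = 1 * L ^ (sx + 1) := by ring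
      _ ≤ (sx + 1) * L ^ (sx + 1) := Nat.mul_le_mul_right _ (by omega)

/-- Monotonicity of `k ↦ k L^k` for `L ≥ 1`. [folklore] -/
theorem mul_pow_le_mul_pow {a k L : ℕ} (hak : a ≤ k) (hL : 1 ≤ L) : a * L ^ a ≤ k * L ^ k :=
  Nat.mul_le_mul hak (Nat.pow_le_pow_right hL hak)

/-- A polynomial of a quantity `≤ 2^E` (`E`-free constant): `Q(Y) ≤ A 2^{A E} + A` for the constant `A`
of `exists_const_eval_le`, whenever `1 ≤ Y ≤ 2^E`. [folklore] -/
theorem eval_le_two_pow_of_le {Q : Polynomial ℕ} {A : ℕ} (hA : ∀ n : ℕ, 1 ≤ n → Q.eval n ≤ A * n ^ A + A)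
    {Y E : ℕ} (h1 : 1 ≤ Y) (hY : Y ≤ 2 ^ E) : Q.eval Y ≤ A * 2 ^ (A * E) + A := by
  calc Q.eval Y ≤ A * Y ^ A + A := hA Y h1
    _ ≤ A * (2 ^ E) ^ A + A := Nat.add_le_add_right (Nat.mul_le_mul_left A (Nat.pow_le_pow_left hY A)) A
    _ = A * 2 ^ (A * E) + A := by rw [← pow_mul, Nat.mul_comm E A]

variable {Ref F}

/-- **The simulating pair language is in `NTIME T` for every `T ≥ 2^{k (log₂ t + 2)ᵏ}` (a.e.),
`k ≥ sx + 1`.** The clock stage costs a polynomial in `Y = |X| + m ℓ + T(n) + 2^{σ*}`, the body a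
polynomial in `|preQ X| + window X ≤ O(Y)` plus `V`'s own `c_V t(n) + c_V`; with `ℓ, n ≤ |X|`,
`m ℓ ≤ t ℓ + O(1)`, `t` monotone, `|X| ≤ t|X|` one has `Y ≤ 2^{E}`,
`E = (c+1)(L + cv)^{sx} + L + O(1)`, `L = log₂ t|X| + 2` (`clog_succ_le_of_le`), so everything is
`≤ K₁ 2^{K₂ (L + cv)^{sx}} + K₁ ≤ K₁ 2^{(sx+1) L^{sx+1}} + O(1)` (`exists_two_pow_mul_pow_le`)
`≤ K₁ 2^{k L^k} + O(1) ≤ K₁ T|X| + O(1)`. No constructibility of `T` is needed (an upper bound;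
`mem_NTIME_of_prefixMachine_pre`). [folklore] -/
theorem exists_simLang_mem_NTIME (hsx : 1 ≤ sx) (hRef : Ref ∈ Classes.P) (hF : F ∈ FP) :
    ∀ (t m : ℕ → ℕ) {L : Language Bool} (V : NVerifier t L),
      IsTimeConstructible t → Monotone t → IsTimeConstructible m → (∀ᶠ n in atTop, m n ≤ t n) →
      1 ≤ V.c → ∀ k : ℕ, sx + 1 ≤ k → ∀ T : ℕ → ℕ,
        (∀ᶠ n in atTop, 2 ^ (k * (Nat.log 2 (t n) + 2) ^ k) ≤ T n) →
        simLang Ref F c sx QN t m V ∈ NTIME T := by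
  obtain ⟨P₁, hP₁⟩ := exists_clock_machine c sx
  obtain ⟨Q, hQ⟩ := exists_body_machine c sx QN hRef hF
  obtain ⟨A₁, hA₁⟩ := EasyWitness.exists_const_eval_le P₁
  obtain ⟨A₂, hA₂⟩ := EasyWitness.exists_const_eval_le (Q.comp (56 * X + 58))
  intro t m L V ht htmono hm hmt hc k hk T hT
  obtain ⟨C, N, hN⟩ := hP₁ t m V.c hm ht hc
  obtain ⟨S, hS⟩ := hQ t m V
  obtain ⟨M₀, hM₀⟩ := MWSimN.exists_add_const_of_eventually_le hmt
  obtain ⟨ET, hET⟩ := MWSimN.exists_add_const_of_eventually_le hT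
  -- the constants
  obtain ⟨Cθ, hCθ⟩ : ∃ Cθ : ℕ, Cθ = V.c + M₀ + V.c + 2 := ⟨_, rfl⟩
  obtain ⟨cv, hcv⟩ : ∃ cv : ℕ, cv = Nat.size (V.c + 1) := ⟨_, rfl⟩
  obtain ⟨A, hA⟩ : ∃ A : ℕ, A = A₁ + A₂ + 1 := ⟨_, rfl⟩
  obtain ⟨K₂, hK₂⟩ : ∃ K₂ : ℕ, K₂ = A * (c + Cθ + 3) := ⟨_, rfl⟩
  obtain ⟨D, hD⟩ := exists_two_pow_mul_pow_le K₂ cv sx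
  obtain ⟨K₁, hK₁⟩ : ∃ K₁ : ℕ, K₁ = C * A₁ + A₂ + 60 := ⟨_, rfl⟩
  refine mem_NTIME_of_prefixMachine_pre (preQ c sx t m V.c) (MWSimN.window t m V.c)
    (verdictBit Ref F c sx QN t m V) N S
    (fun Xw => C * P₁.eval (Xw.length + m (MWSimN.xIn Xw).length + MWSimN.wlen t V.c Xw +
      2 ^ sigMax c sx (MWSimN.wlen t V.c Xw)))
    (fun Xw => Q.eval (boolPair (preQ c sx t m V.c Xw)
      (List.replicate (MWSimN.window t m V.c Xw) true)).length + (V.c * t (MWSimN.xhIn Xw).length + V.c))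
    hN (fun Xw zp hzp => ?_) (fun Xw => Iff.rfl) (K₁ * (ET + D) + 2 * K₁) (fun Xw => ?_)
  · -- the body on a witness inside the window
    have h := hS Xw (padOf c sx (MWSimN.wlen t V.c Xw)) zp
    rw [bodyOut_padOf] at h
    have e1 : encodeBool (verdictBit Ref F c sx QN t m V Xw zp) = [verdictBit Ref F c sx QN t m V Xw zp] := by
      cases verdictBit Ref F c sx QN t m V Xw zp <;> rfl
    rw [e1]
    refine (h.mono (Nat.add_le_add_right (TM2Iter.eval_mono _ ?_) _))
    simp only [preQ, length_boolPair, List.length_replicate]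
    omega
  · -- the total cost
    set Nw := Xw.length with hNw
    set u := t Nw with hu
    set Lu := Nat.log 2 u + 2 with hLu
    have hℓ : (MWSimN.xIn Xw).length ≤ Nw := MWSimN.length_xIn_le Xw
    have hn : (MWSimN.xhIn Xw).length ≤ Nw := MWSimN.length_xhIn_le Xw
    have hXt : Nw ≤ u := ht.1 _
    have hmℓ : m (MWSimN.xIn Xw).length ≤ u + M₀ :=
      (hM₀ _).trans (Nat.add_le_add_right (htmono hℓ) _)
    have hTn : MWSimN.wlen t V.c Xw ≤ V.c * u + V.c :=
      Nat.add_le_add_right (Nat.mul_le_mul_left _ (htmono hn)) _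
    -- `Λ ≤ Cθ (u + 1) ≤ 2^{Lu + Cθ}`
    set Λ := Nw + m (MWSimN.xIn Xw).length + MWSimN.wlen t V.c Xw with hΛ
    have hu2 : u + 1 ≤ 2 ^ (Nat.log 2 u + 1) := Nat.lt_pow_succ_log_self one_lt_two u
    have hΛ' : Λ ≤ Cθ * (u + 1) := by
      have e2 : Cθ * (u + 1) = V.c * u + M₀ * u + V.c * u + 2 * u + (V.c + M₀ + V.c + 2) := by
        rw [hCθ]; ring
      rw [e2, hΛ]
      have : 0 ≤ M₀ * u := Nat.zero_le _
      omega
    have hCθ2 : Cθ ≤ 2 ^ Cθ := (Nat.lt_two_pow_self).le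
    have hΛ2 : Λ ≤ 2 ^ (Lu + Cθ) := by
      calc Λ ≤ Cθ * (u + 1) := hΛ'
        _ ≤ 2 ^ Cθ * 2 ^ (Nat.log 2 u + 1) := Nat.mul_le_mul hCθ2 hu2
        _ = 2 ^ (Cθ + (Nat.log 2 u + 1)) := by rw [← pow_add]
        _ ≤ 2 ^ (Lu + Cθ) := Nat.pow_le_pow_right two_pos (by rw [hLu]; omega)
    -- `σ* ≤ (c+1) (Lu + cv)^sx`
    set σ := sigMax c sx (MWSimN.wlen t V.c Xw) with hσ
    have hclog : Nat.clog 2 (MWSimN.wlen t V.c Xw + 1) ≤ Lu + cv := by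
      rw [hLu, hcv]; exact clog_succ_le_of_le _ u V.c hTn
    have hsx1 : 1 ≤ sx := hsx
    have hbase1 : 1 ≤ Lu + cv := by omega
    have hbase : Lu + cv ≤ (Lu + cv) ^ sx := by
      calc Lu + cv = (Lu + cv) ^ 1 := (pow_one _).symm
        _ ≤ (Lu + cv) ^ sx := Nat.pow_le_pow_right hbase1 hsx1
    have hσle : σ ≤ (c + 1) * (Lu + cv) ^ sx := by
      rw [hσ, sigMax]
      calc c * Nat.clog 2 (MWSimN.wlen t V.c Xw + 1) ^ sx + Nat.clog 2 (MWSimN.wlen t V.c Xw + 1)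
          ≤ c * (Lu + cv) ^ sx + (Lu + cv) :=
            Nat.add_le_add (Nat.mul_le_mul_left c (Nat.pow_le_pow_left hclog sx)) hclog
        _ ≤ c * (Lu + cv) ^ sx + (Lu + cv) ^ sx := Nat.add_le_add_left hbase _
        _ = (c + 1) * (Lu + cv) ^ sx := by ring
    -- `Y = Λ + 2^σ ≤ 2^E`, `E ≤ K₂/A (Lu + cv)^sx`
    set Y := Λ + 2 ^ σ with hY
    set E := (c + 1) * (Lu + cv) ^ sx + (Lu + Cθ) + 1 with hE
    have hY1 : 1 ≤ Y := le_add_left Nat.one_le_two_pow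
    have hYE : Y ≤ 2 ^ E := by
      calc Y ≤ 2 ^ (Lu + Cθ) + 2 ^ σ := Nat.add_le_add_right hΛ2 _
        _ ≤ 2 ^ ((Lu + Cθ) + σ + 1) := two_pow_add_two_pow_le _ _
        _ ≤ 2 ^ E := Nat.pow_le_pow_right two_pos (by rw [hE]; omega)
    have hE' : A * E ≤ K₂ * (Lu + cv) ^ sx := by
      have h1 : Lu + Cθ + 1 ≤ (Cθ + 2) * (Lu + cv) ^ sx := by
        have : 1 ≤ (Lu + cv) ^ sx := Nat.one_le_pow _ _ hbase1
        nlinarith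
      calc A * E = A * ((c + 1) * (Lu + cv) ^ sx + (Lu + Cθ + 1)) := by rw [hE]; ring
        _ ≤ A * ((c + 1) * (Lu + cv) ^ sx + (Cθ + 2) * (Lu + cv) ^ sx) :=
            Nat.mul_le_mul_left A (Nat.add_le_add_left h1 _)
        _ = K₂ * (Lu + cv) ^ sx := by rw [hK₂]; ring
    -- the pieces of the cost
    have hpre : (MWSimN.pre t m V.c Xw).length ≤ 12 * Λ + 12 := by
      simp only [MWSimN.pre, length_boolPair, ones, List.length_replicate]
      have := MWSimN.length_advIn_le Xw
      omega
    have hΛY : Λ ≤ Y := Nat.le_add_right _ _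
    have hσY : 2 ^ σ ≤ Y := Nat.le_add_left _ _
    have hpreQ : (preQ c sx t m V.c Xw).length ≤ 26 * Y + 27 := by
      have e4 : (preQ c sx t m V.c Xw).length =
          2 * (MWSimN.pre t m V.c Xw).length + 2 + (2 ^ σ + 1) := by
        rw [preQ, length_boolPair, length_padOf]
      rw [e4]
      have h24 : 2 * (MWSimN.pre t m V.c Xw).length ≤ 24 * Y + 24 := by
        calc 2 * (MWSimN.pre t m V.c Xw).length ≤ 2 * (12 * Λ + 12) := Nat.mul_le_mul_left 2 hpre
          _ ≤ 2 * (12 * Y + 12) := Nat.mul_le_mul_left 2 (by omega)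
          _ = 24 * Y + 24 := by ring
      omega
    have hwlenΛ : MWSimN.wlen t V.c Xw ≤ Λ := by rw [hΛ]; omega
    have hmΛ : m (MWSimN.xIn Xw).length ≤ Λ := by rw [hΛ]; omega
    have hwin : MWSimN.window t m V.c Xw ≤ 2 * Y + 2 := by
      have e5 : MWSimN.window t m V.c Xw = 2 * MWSimN.wlen t V.c Xw + 2 + m (MWSimN.xIn Xw).length := rfl
      rw [e5]
      have := Nat.mul_le_mul_left 2 hwlenΛ
      omega
    have hbodyIn : (boolPair (preQ c sx t m V.c Xw) (List.replicate (MWSimN.window t m V.c Xw) true)).length ≤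
        56 * Y + 58 := by
      rw [length_boolPair, List.length_replicate]
      have := Nat.mul_le_mul_left 2 hpreQ
      omega
    have hAE : 2 ^ (A * E) ≤ 2 ^ (K₂ * (Lu + cv) ^ sx) := Nat.pow_le_pow_right two_pos hE'
    have hA1E : 2 ^ (A₁ * E) ≤ 2 ^ (A * E) :=
      Nat.pow_le_pow_right two_pos (Nat.mul_le_mul_right _ (by rw [hA]; omega))
    have hA2E : 2 ^ (A₂ * E) ≤ 2 ^ (A * E) :=
      Nat.pow_le_pow_right two_pos (Nat.mul_le_mul_right _ (by rw [hA]; omega))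
    have hYAE : Y ≤ 2 ^ (A * E) :=
      hYE.trans (Nat.pow_le_pow_right two_pos (Nat.le_mul_of_pos_left E (by rw [hA]; omega)))
    -- `τ₁ ≤ C (A₁ 2^{A E} + A₁)`
    have hτ₁ : C * P₁.eval Y ≤ C * (A₁ * 2 ^ (A * E) + A₁) := by
      refine Nat.mul_le_mul_left C ((eval_le_two_pow_of_le hA₁ hY1 hYE).trans ?_)
      exact Nat.add_le_add_right (Nat.mul_le_mul_left _ hA1E) _
    -- `τ₂ ≤ A₂ 2^{A E} + A₂ + Y`
    have hQ' : Q.eval (boolPair (preQ c sx t m V.c Xw) (List.replicate (MWSimN.window t m V.c Xw) true)).length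
        ≤ A₂ * 2 ^ (A * E) + A₂ := by
      have h1 : Q.eval (boolPair (preQ c sx t m V.c Xw)
          (List.replicate (MWSimN.window t m V.c Xw) true)).length ≤ (Q.comp (56 * X + 58)).eval Y := by
        rw [eval_comp]; exact TM2Iter.eval_mono _ (by simp only [eval_add, eval_mul, eval_ofNat, eval_X]; exact hbodyIn)
      refine h1.trans ((eval_le_two_pow_of_le hA₂ hY1 hYE).trans ?_)
      exact Nat.add_le_add_right (Nat.mul_le_mul_left _ hA2E) _
    have hVt : V.c * t (MWSimN.xhIn Xw).length + V.c ≤ Y := hwlenΛ.trans hΛY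
    -- the key domination `2^{K₂ (Lu+cv)^sx} ≤ 2^{k Lu^k} + D ≤ T Nw + ET + D`
    have hLu1 : 1 ≤ Lu := by omega
    have hkey : 2 ^ (K₂ * (Lu + cv) ^ sx) ≤ T Nw + ET + D := by
      calc 2 ^ (K₂ * (Lu + cv) ^ sx) ≤ 2 ^ ((sx + 1) * Lu ^ (sx + 1)) + D := hD Lu
        _ ≤ 2 ^ (k * Lu ^ k) + D :=
            Nat.add_le_add_right (Nat.pow_le_pow_right two_pos (mul_pow_le_mul_pow hk hLu1)) D
        _ ≤ T Nw + ET + D := Nat.add_le_add_right (by rw [hLu, hu]; exact hET Nw) D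
    -- assemble
    have hNY : Nw ≤ Y := le_trans (by rw [hΛ]; omega) hΛY
    set W₂ := 2 ^ (A * E) with hW₂
    have hsum : C * P₁.eval Y + (Q.eval (boolPair (preQ c sx t m V.c Xw)
        (List.replicate (MWSimN.window t m V.c Xw) true)).length + (V.c * t (MWSimN.xhIn Xw).length + V.c)) +
        MWSimN.window t m V.c Xw + (preQ c sx t m V.c Xw).length + Nw ≤ K₁ * W₂ + K₁ := by
      calc C * P₁.eval Y + (Q.eval (boolPair (preQ c sx t m V.c Xw)
            (List.replicate (MWSimN.window t m V.c Xw) true)).length + (V.c * t (MWSimN.xhIn Xw).length + V.c)) +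
            MWSimN.window t m V.c Xw + (preQ c sx t m V.c Xw).length + Nw
          ≤ C * (A₁ * W₂ + A₁) + ((A₂ * W₂ + A₂) + Y) + (2 * Y + 2) + (26 * Y + 27) + Y :=
            Nat.add_le_add (Nat.add_le_add (Nat.add_le_add (Nat.add_le_add hτ₁
              (Nat.add_le_add hQ' hVt)) hwin) hpreQ) hNY
        _ = C * (A₁ * W₂ + A₁) + (A₂ * W₂ + A₂) + (30 * Y + 29) := by ring
        _ ≤ C * (A₁ * W₂ + A₁) + (A₂ * W₂ + A₂) + (30 * W₂ + 29) :=
            Nat.add_le_add_left (Nat.add_le_add_right (Nat.mul_le_mul_left 30 hYAE) 29) _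
        _ ≤ K₁ * W₂ + K₁ := by
            rw [hK₁]
            have e6 : (C * A₁ + A₂ + 60) * W₂ + (C * A₁ + A₂ + 60) =
                C * (A₁ * W₂ + A₁) + (A₂ * W₂ + A₂) + (60 * W₂ + 60) := by ring
            rw [e6]
            omega
    calc _ ≤ K₁ * W₂ + K₁ := hsum
      _ ≤ K₁ * (T Nw + ET + D) + K₁ := Nat.add_le_add_right (Nat.mul_le_mul_left K₁ (hAE.trans hkey)) K₁
      _ = K₁ * T Nw + (K₁ * (ET + D) + K₁) := by ring
      _ ≤ (K₁ * (ET + D) + 2 * K₁) * T Nw + (K₁ * (ET + D) + 2 * K₁) := by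
          refine Nat.add_le_add (Nat.mul_le_mul_right _ (by omega)) (by omega)

end Language

end MWSimQN

end Literature.Computability.Complexity

end
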